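import Literature.NumberTheory.LFunctions.Zhang2022.Section2AllIotaWitness

/-!
# Zhang 2022, the final step of §2 at main order: joint robustness against all entry-level constants

Trunk T-NT (NumberTheory/LFunctions), the Landau–Siegel manuscript [Zhang2022LandauSiegel]
(Y. Zhang, *Discrete mean estimates and the Landau–Siegel zero*, arXiv:2211.02515v1 — an unrefereed
manuscript, a claimed result under adjudication; audit + repair census, no claim about Landau–Siegel).

`Section2AllIota.not_mainOrderContradictionG_all` shows that the final step of §2 at main order,
`√(C₂₃₂(ι)·C₂₃₃) < |𝔡′(ι) + 𝔡(ι)|`, fails for EVERY `ι = (ι₂, ι₃, ι₄) ∈ ℂ³` with the certified constants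
(`|𝔡′ + 𝔡|² ≤ 1040·C₂₃₂(ι)` against `C₂₃₃ > 2546.8`), and `not_mainOrderContradictionG_robust` /
`Section2ShiftWitness` quantify ONE-SIDED slack in the (2.32)-side.  This file answers the remaining numerical
"what if the constants are slightly off" question at the level of the thirteen ENTRY-LEVEL numbers of the step —
the entries `c₁₁, c₂₂, c₃₃, c₄₄, c₁₂, c₃₄, Q₃₁, Q₃₂, Q₄₁, Q₄₂` of the Hermitian matrix `Q` of the (2.32)-side
`C₂₃₂(ι) = x* Q x` (`x = (1, ι₂, ι₃, ι₄)`, `Section18AllIota.QM`, `0.5`-prefactor `c₃₄`) and the coefficients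
`A₀, A₂, A₃, A₄` of `𝔡′(ι) + 𝔡(ι) = A₀ + ι₂A₂ + ι₃A₃ + ι₄A₄` (`Section2AllIota.Lform`) — ALL AT ONCE:

* `not_mainOrderContradictionP` — for every Hermitian perturbation `D` of `Q` and every perturbation `d` of
  `(A₀, A₂, A₃, A₄)` whose real and imaginary parts are all at most **`3·10⁻⁴`** in absolute value
  (`Small (3/10000) D d`; `24` real degrees of freedom, `c₄₄ = c₂₂` untied, signs and values arbitrary), and for
  every `ι ∈ ℂ³`: `¬ (√(C₂₃₂′(ι)·C₂₃₃) < |L′(ι)|)` with `C₂₃₂′(ι) = x*(Q + D)x`, `L′(ι) = Σ (A_k + d_k) x_k`, in both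
  readings of `C₂₃₃` ((10.19) as printed, `C233`; with the literal (10.9), `C233lit`).  Mechanism:
  `2546·(Q + D) − (a + d)(a + d)* ⪰ 0` for all such `(D, d)` SIMULTANEOUSLY, by ONE run of the kernel test
  `IntervalGershgorin.hermPsdCheck` on the literal boxes of the parent files (`Section18AllIota.QLitC`,
  `Section2AllIota.ALit0…ALit4`) WIDENED by `3·10⁻⁴·2^48` (`certR`, `decide +kernel`); hence
  `|L′(ι)|² ≤ 2546·C₂₃₂′(ι)` (`normSq_LP_le`) and `2546 < C₂₃₃`.
* `witnessP_closes` — conversely an explicit admissible perturbation of sup-size **`6.64·10⁻⁴`** (every one of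
  the 24 components moved by `±6.64·10⁻⁴` in the pattern `sRe`/`sIm`/`sdRe`/`sdIm`, found outside Lean as the
  adversarial vertex; only the rounded literals enter) DOES close the step, at the complex-rational point
  `ι_w = (1.52727 − 0.07441i, −0.97104 − 0.24758i, −1.48787 + 0.41210i)`, in both readings of `C₂₃₃`
  (box evaluation as in `Section2AllIotaWitness`, `witnessP_cert`).
* `joint_radius_bracket` — hence the least sup-size `ρ*` of a joint perturbation of the entry-level constants under
  which SOME `ι` closes the final step satisfies **`3·10⁻⁴ ≤ ρ* < 6.64·10⁻⁴`** (the repair-census sensitivity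
  sweep certifies `5.438·10⁻⁴ ≤ ρ* ≤ 6.628·10⁻⁴` outside Lean by a Weyl bound in exact rational arithmetic; the
  manuscript quotes these constants to `10⁻⁵`).  At `D = 0`, `d = 0` the statement is the parent file's
  (`mainOrderContradictionP_zero`).

As everywhere in this series nothing is asserted about the manuscript's Theorems 1–2: the statements concern the
printed main-order constants as functions of the free parameters `ι` and a fictitious perturbation `(D, d)`.

## Method

`NP D d = 2546·(Q + D) − (a + d)†(a + d)ᵀ` is Hermitian for Hermitian `D` (`NP_conjTranspose`) and lies, entry by
entry, in the box table `NPBox E3` built from the literal boxes and the symmetric boxes `[−E3, E3]·2⁻⁴⁸`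
(`mem_NPBox`; a diagonal entry of a Hermitian `D` is real, `EBr`); `certR : hermPsdCheck (NPBox E3) VR = true` with
an integer approximate eigenbasis `VR` (columns scaled by `ℓ¹-norm/eigenvalue`, computed outside Lean) gives
`NP D d ⪰ 0` (`IntervalGershgorinHermitian.posSemidef_of_hermPsdCheck`), and the form identity `form_NP_re` turns
`0 ≤ Re x*(NP D d)x` into `|L′(ι)|² ≤ 2546·C₂₃₂′(ι)`.  The witness is two-plus-one integer endpoint comparisons
(`WitnessPProp`).  No facts, no axioms beyond the parent files'.

## Main results
* `Small`, `C232P`, `LP`, `MainOrderContradictionP`, `mainOrderContradictionP_zero`.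
* `certR`, `NP_posSemidef`, `normSq_LP_le`, `not_mainOrderContradictionP`.
* `small_W`, `witnessP_cert`, `witnessP_closes`, `joint_radius_bracket`.
-/

noncomputable section

open Real Complex ComplexConjugate Matrix
open scoped ComplexOrder
open Literature.Analysis.ValidatedNumerics.Numerics
open Literature.Analysis.ValidatedNumerics.IntervalGershgorin

namespace Literature.NumberTheory.LFunctions.Zhang2022

/-! ### Joint perturbations of the entry-level constants -/

/-- the coefficient vector `(A₀, A₂, A₃, A₄)` of `L(ι) = 𝔡′(ι) + 𝔡(ι)` (`Lform`). [folklore] -/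
def avec : Fin 4 → ℂ := ![A0, A2, A3, A4]

/-- **admissible joint perturbation of sup-size `ε`**: a Hermitian perturbation `D` of the matrix `Q` of the
(2.32)-side and a perturbation `d` of `(A₀, A₂, A₃, A₄)`, every real and imaginary part at most `ε` in absolute
value (`16 + 8` complex entries; `24` real degrees of freedom after Hermitian symmetry). [folklore] -/
def Small (ε : ℝ) (D : Matrix (Fin 4) (Fin 4) ℂ) (d : Fin 4 → ℂ) : Prop :=
  Dᴴ = D ∧ (∀ i j, |(D i j).re| ≤ ε ∧ |(D i j).im| ≤ ε) ∧ ∀ k, |(d k).re| ≤ ε ∧ |(d k).im| ≤ ε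

/-- monotonicity in the size. [folklore] -/
theorem Small.mono {ε ε' : ℝ} {D : Matrix (Fin 4) (Fin 4) ℂ} {d : Fin 4 → ℂ} (h : Small ε D d) (hle : ε ≤ ε') :
    Small ε' D d :=
  ⟨h.1, fun i j => ⟨(h.2.1 i j).1.trans hle, (h.2.1 i j).2.trans hle⟩,
    fun k => ⟨(h.2.2 k).1.trans hle, (h.2.2 k).2.trans hle⟩⟩

/-- the zero perturbation is admissible. [folklore] -/
theorem small_zero {ε : ℝ} (hε : 0 ≤ ε) : Small ε 0 0 := by
  refine ⟨Matrix.conjTranspose_zero, fun i j => ?_, fun k => ?_⟩ <;> simp [hε]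

/-- the perturbed (2.32)-side `C₂₃₂′(ι) = Re x*(Q + D)x = C₂₃₂(ι) + Re x*Dx` (`0.5`-prefactor `c₃₄`). [folklore] -/
def C232P (D : Matrix (Fin 4) (Fin 4) ℂ) (w2 w3 w4 : ℂ) : ℝ :=
  C232cG w2 w3 w4 + (star (xvec w2 w3 w4) ⬝ᵥ (D *ᵥ xvec w2 w3 w4)).re

/-- the perturbed `𝔡′(ι) + 𝔡(ι)`: `L′(ι) = (𝔡′ + 𝔡)(ι) + (d₀ + ι₂d₁ + ι₃d₂ + ι₄d₃)`. [folklore] -/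
def LP (d : Fin 4 → ℂ) (w2 w3 w4 : ℂ) : ℂ :=
  dprimeG w3 + dfrakG w2 w3 w4 + (d 0 + w2 * d 1 + w3 * d 2 + w4 * d 3)

/-- the same in coefficient form `Σ (A_k + d_k) x_k`. [folklore] -/
def LformP (d : Fin 4 → ℂ) (w2 w3 w4 : ℂ) : ℂ :=
  (A0 + d 0) + w2 * (A2 + d 1) + w3 * (A3 + d 2) + w4 * (A4 + d 3)

/-- [folklore] -/
theorem LP_eq (d : Fin 4 → ℂ) (w2 w3 w4 : ℂ) : LP d w2 w3 w4 = LformP d w2 w3 w4 := by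
  unfold LP LformP
  rw [dsumG_eq]
  unfold Lform
  ring

/-- **the perturbed final step of §2 at main order**: `√(C₂₃₂′(ι)·C₂₃₃) < |L′(ι)|`. [folklore] -/
def MainOrderContradictionP (D : Matrix (Fin 4) (Fin 4) ℂ) (d : Fin 4 → ℂ) (w2 w3 w4 : ℂ) (c233 : ℝ) : Prop :=
  Real.sqrt (C232P D w2 w3 w4 * c233) < ‖LP d w2 w3 w4‖

/-- at `D = 0`, `d = 0` it is the parent file's `MainOrderContradictionG` (reading `C232cG`). [folklore] -/
theorem mainOrderContradictionP_zero (w2 w3 w4 : ℂ) (c233 : ℝ) :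
    MainOrderContradictionP 0 0 w2 w3 w4 c233 ↔ MainOrderContradictionG w2 w3 w4 (C232cG w2 w3 w4) c233 := by
  simp [MainOrderContradictionP, MainOrderContradictionG, C232P, LP]

/-! ### The matrix `2546·(Q + D) − (a + d)†(a + d)ᵀ` -/

/-- `NP D d`: entries `2546·(Q_ij + D_ij) − conj(A_i + d_i)(A_j + d_j)`. [folklore] -/
def NP (D : Matrix (Fin 4) (Fin 4) ℂ) (d : Fin 4 → ℂ) : Matrix (Fin 4) (Fin 4) ℂ :=
  Matrix.of fun i j => ((2546 : ℕ) : ℂ) * (QM c34c 0 i j + D i j) - conj (avec i + d i) * (avec j + d j)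

/-- **form identity**: `x*(NP D d)x = 2546·(x*Qx + x*Dx) − conj L′ · L′`. [folklore] -/
theorem form_NP (D : Matrix (Fin 4) (Fin 4) ℂ) (d : Fin 4 → ℂ) (w2 w3 w4 : ℂ) :
    star (xvec w2 w3 w4) ⬝ᵥ (NP D d *ᵥ xvec w2 w3 w4)
      = ((2546 : ℕ) : ℂ) * (star (xvec w2 w3 w4) ⬝ᵥ (QM c34c 0 *ᵥ xvec w2 w3 w4)
          + star (xvec w2 w3 w4) ⬝ᵥ (D *ᵥ xvec w2 w3 w4)) - conj (LformP d w2 w3 w4) * LformP d w2 w3 w4 := by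
  simp only [NP, LformP, avec, xvec, Matrix.mulVec, dotProduct, Fin.sum_univ_four, Matrix.of_apply,
    Matrix.cons_val_zero, Matrix.cons_val_one, Matrix.cons_val, Pi.star_apply, Complex.star_def, map_one,
    map_add, map_mul]
  ring

/-- `NP D d` is Hermitian for Hermitian `D`. [folklore] -/
theorem NP_conjTranspose {D : Matrix (Fin 4) (Fin 4) ℂ} (hD : Dᴴ = D) (d : Fin 4 → ℂ) : (NP D d)ᴴ = NP D d := by
  ext i j
  have hq : conj (QM c34c 0 j i) = QM c34c 0 i j := by
    simpa [Matrix.conjTranspose_apply] using congrFun (congrFun (QM_conjTranspose c34c 0) i) j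
  have hd : conj (D j i) = D i j := by
    simpa [Matrix.conjTranspose_apply] using congrFun (congrFun hD i) j
  simp only [NP, Matrix.conjTranspose_apply, Matrix.of_apply, Complex.star_def, map_sub, map_mul, map_add,
    map_natCast, Complex.conj_conj, hq, hd]
  ring

/-- `Re x*(NP D d)x = 2546·C₂₃₂′(ι) − |L′(ι)|²`. [folklore] -/
theorem form_NP_re (D : Matrix (Fin 4) (Fin 4) ℂ) (d : Fin 4 → ℂ) (w2 w3 w4 : ℂ) :
    (star (xvec w2 w3 w4) ⬝ᵥ (NP D d *ᵥ xvec w2 w3 w4)).re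
      = 2546 * C232P D w2 w3 w4 - Complex.normSq (LformP d w2 w3 w4) := by
  have hq : (star (xvec w2 w3 w4) ⬝ᵥ (QM c34c 0 *ᵥ xvec w2 w3 w4)).re = C232cG w2 w3 w4 := by
    rw [form_QM_re, Rat.cast_zero, sub_zero]; rfl
  rw [form_NP, ← Complex.normSq_eq_conj_mul_self]
  unfold C232P
  rw [← hq]
  simp only [Complex.sub_re, Complex.mul_re, Complex.add_re, Complex.add_im, Complex.natCast_re,
    Complex.natCast_im, Complex.ofReal_re]
  push_cast
  ring

/-! ### Box table and kernel certificate -/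

/-- literal box table of `Q` (`0.5`-prefactor `c₃₄`): `Section18AllIota.QLitC` (boxes of `Q − 0.02491·e₀e₀ᵀ`)
with `+ 0.02491` restored at `(0,0)`. [folklore] -/
def QL : CMat 4 := fun i j => if i = 0 ∧ j = 0 then (QLitC 0 0).add (qCB (2491/100000)) else QLitC i j

/-- `Q ∈ QL` entrywise. [folklore] -/
theorem mem_QL : CMMem (QM c34c 0) QL := by
  have h := cmmem_of_cmatEncl cert18all_c.1 (mem_QBox mem_c34c (2491/100000 : ℚ))
  intro i j
  by_cases hij : i = 0 ∧ j = 0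
  · obtain ⟨rfl, rfl⟩ := hij
    have h00 := CB.mem_add (h 0 0) (mem_qCB (2491/100000 : ℚ))
    have e : QM c34c (2491/100000 : ℚ) 0 0 + (((2491/100000 : ℚ)) : ℂ) = QM c34c 0 0 0 := by
      simp [QM]
    rw [e] at h00
    simpa [QL] using h00
  · have e : QM c34c 0 i j = QM c34c (2491/100000 : ℚ) i j := by
      fin_cases i <;> fin_cases j <;> simp_all [QM]
    simp only [QL, if_neg hij, e]
    exact h i j

/-- the box `[−E, E]·2⁻⁴⁸ × [−E, E]·2⁻⁴⁸`. [folklore] -/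
def EB (E : ℕ) : CB := ⟨⟨-(E : ℤ), E⟩, ⟨-(E : ℤ), E⟩⟩

/-- the box `[−E, E]·2⁻⁴⁸ × {0}` (diagonal entries of a Hermitian perturbation are real). [folklore] -/
def EBr (E : ℕ) : CB := ⟨⟨-(E : ℤ), E⟩, ⟨0, 0⟩⟩

/-- `|x| ≤ ε`, `ε·2^48 ≤ E` ⟹ `x ∈ [−E, E]·2⁻⁴⁸`. [folklore] -/
theorem fi_mem_of_abs_le {x ε : ℝ} {E : ℕ} (hE : ε * SC ≤ E) (hx : |x| ≤ ε) : FI.mem x ⟨-(E : ℤ), E⟩ := by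
  rw [abs_le] at hx
  have hS := SC_pos
  constructor
  · push_cast; nlinarith
  · push_cast; nlinarith

/-- [folklore] -/
theorem mem_EB {z : ℂ} {ε : ℝ} {E : ℕ} (hE : ε * SC ≤ E) (hr : |z.re| ≤ ε) (hi : |z.im| ≤ ε) :
    CB.mem z (EB E) :=
  ⟨fi_mem_of_abs_le hE hr, fi_mem_of_abs_le hE hi⟩

/-- [folklore] -/
theorem mem_EBr {z : ℂ} {ε : ℝ} {E : ℕ} (hE : ε * SC ≤ E) (hr : |z.re| ≤ ε) (hi : z.im = 0) :
    CB.mem z (EBr E) := by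
  refine ⟨fi_mem_of_abs_le hE hr, ?_⟩
  rw [hi]
  constructor <;> simp [EBr]

/-- the literal boxes of `(A₀, A₂, A₃, A₄)` (`Section2AllIota.ALit0…ALit4`). [folklore] -/
def ALv : Fin 4 → CB := ![ALit0, ALit2, ALit3, ALit4]

/-- `A_k ∈ ALv k`. [folklore] -/
theorem mem_avec : ∀ k, CB.mem (avec k) (ALv k) := by
  intro k
  fin_cases k
  · exact mem_A0L
  · exact mem_A2L
  · exact mem_A3L
  · exact mem_A4L

/-- the certified radius at scale `2^48`: `⌈3·10⁻⁴ · 2^48⌉`. [folklore] -/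
def E3 : ℕ := 84442493014

/-- `3·10⁻⁴ · 2^48 ≤ E3`. [folklore] -/
theorem E3_spec : (3 / 10000 : ℝ) * SC ≤ E3 := by norm_num [SC, E3]

/-- box table of `NP D d` for every admissible `(D, d)` of scaled size `≤ E`: entries
`2546·(QL_ij + [±E](×[±E] off the diagonal)) − conj(ALv_i + [±E]²)·(ALv_j + [±E]²)`. [folklore] -/
def NPBox (E : ℕ) : CMat 4 := fun i j =>
  ((CB.ofInt 2546).mul ((QL i j).add (if i = j then EBr E else EB E))).sub
    (((ALv i).add (EB E)).conj.mul ((ALv j).add (EB E)))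

/-- `NP D d ∈ NPBox E` entrywise for admissible `(D, d)` with `ε·2^48 ≤ E`. [folklore] -/
theorem mem_NPBox {ε : ℝ} {E : ℕ} {D : Matrix (Fin 4) (Fin 4) ℂ} {d : Fin 4 → ℂ} (hS : Small ε D d)
    (hE : ε * SC ≤ E) : CMMem (NP D d) (NPBox E) := by
  obtain ⟨hH, hD, hd⟩ := hS
  intro i j
  have hDij : CB.mem (D i j) (if i = j then EBr E else EB E) := by
    split_ifs with hij
    · subst hij
      have him : (D i i).im = 0 := by
        have h1 := congrFun (congrFun hH i) i
        simp only [Matrix.conjTranspose_apply, Complex.star_def] at h1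
        exact Complex.conj_eq_iff_im.1 h1
      exact mem_EBr hE (hD i i).1 him
    · exact mem_EB hE (hD i j).1 (hD i j).2
  have h2546 : CB.mem (((2546 : ℕ)) : ℂ) (CB.ofInt 2546) := mem_natCB 2546
  simp only [NP, NPBox, Matrix.of_apply]
  exact CB.mem_sub (CB.mem_mul h2546 (CB.mem_add (mem_QL i j) hDij))
    (CB.mem_mul (CB.mem_conj (CB.mem_add (mem_avec i) (mem_EB hE (hd i).1 (hd i).2)))
      (CB.mem_add (mem_avec j) (mem_EB hE (hd j).1 (hd j).2)))

/-- integer approximate eigenbasis of the realified midpoint of `NPBox E3` (columns scaled by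
`ℓ¹-norm / eigenvalue`; eigenvalues `7.27, 43.3, 6235, 19025`, each twice), computed outside Lean. [folklore] -/
def VR : Fin (4 + 4) → Fin (4 + 4) → ℤ :=
  ![![147227337, -1536507416, 411979, 446136645, -108462, -579222, 1008473, 225739],
    ![-1857000, -2615135005, 8690188, -262350043, -475442, -2936864, -207094, 11911],
    ![245784478, 1517907638, -82087012, -432296664, 15201, -623109, 1043117, -1096],
    ![-561574756, 2558409426, -15082044, 260810247, 1881, -2975305, -200192, -53941],
    ![1536507416, 147227337, -446136645, 411979, 579222, -108462, -225739, 1008473],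
    ![2615135005, -1857000, 262350043, 8690188, 2936864, -475442, -11911, -207094],
    ![-1517907638, 245784478, 432296664, -82087012, 623109, 15201, 1096, 1043117],
    ![-2558409426, -561574756, -260810247, -15082044, 2975305, 1881, 53941, -200192]]

/-- **Kernel certificate**: the interval Gershgorin test passes on the widened box table. [folklore] -/
theorem certR : hermPsdCheck (NPBox E3) VR = true := by
  decide +kernel

/-- **`2546·(Q + D) − (a + d)†(a + d)ᵀ ⪰ 0` for every admissible `(D, d)` of size `ε` with `ε·2^48 ≤ E3`.**
[folklore] -/
theorem NP_posSemidef {ε : ℝ} {D : Matrix (Fin 4) (Fin 4) ℂ} {d : Fin 4 → ℂ} (hS : Small ε D d)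
    (hE : ε * SC ≤ E3) : (NP D d).PosSemidef :=
  posSemidef_of_hermPsdCheck certR (mem_NPBox hS hE) (NP_conjTranspose hS.1 d)

/-- **`|L′(ι)|² ≤ 2546·C₂₃₂′(ι)` for every `ι` and every admissible perturbation of size `ε`, `ε·2^48 ≤ E3`.**
[folklore] -/
theorem normSq_LP_le {ε : ℝ} {D : Matrix (Fin 4) (Fin 4) ℂ} {d : Fin 4 → ℂ} (hS : Small ε D d)
    (hE : ε * SC ≤ E3) (w2 w3 w4 : ℂ) :
    Complex.normSq (LP d w2 w3 w4) ≤ 2546 * C232P D w2 w3 w4 := by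
  have h0 := (NP_posSemidef hS hE).dotProduct_mulVec_nonneg (xvec w2 w3 w4)
  rw [Complex.nonneg_iff] at h0
  have h1 := h0.1
  rw [form_NP_re] at h1
  rw [LP_eq]
  linarith

/-! ### The lower side: no admissible perturbation of size `≤ 3·10⁻⁴` rescues the step -/

/-- `|L|² ≤ k·c₂₃₂`, `0 ≤ c₂₃₂`, `k ≤ c₂₃₃` exclude `√(c₂₃₂·c₂₃₃) < |L|`. [folklore] -/
theorem not_sqrt_lt_of_normSq_le {L : ℂ} {c232 c233 k : ℝ} (hk : Complex.normSq L ≤ k * c232)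
    (hpos : 0 ≤ c232) (hkc : k ≤ c233) : ¬ (Real.sqrt (c232 * c233) < ‖L‖) := by
  intro h
  have hy : 0 < ‖L‖ := lt_of_le_of_lt (Real.sqrt_nonneg _) h
  rw [Real.sqrt_lt' hy, Complex.sq_norm] at h
  have e2 : k * c232 ≤ c233 * c232 := mul_le_mul_of_nonneg_right hkc hpos
  nlinarith

/-- **Joint robustness.**  For every Hermitian perturbation `D` of `Q` and every perturbation `d` of
`(A₀, A₂, A₃, A₄)` with all real and imaginary parts at most `3·10⁻⁴` in absolute value, and every
`ι = (ι₂, ι₃, ι₄) ∈ ℂ³`, the perturbed final step of §2 at main order fails, in both readings of `C₂₃₃`: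
`|L′(ι)|² ≤ 2546·C₂₃₂′(ι) ≤ C₂₃₃·C₂₃₂′(ι)`.  Componentwise: each of `c₁₁, c₂₂, c₃₃, c₄₄` may be replaced by any
real number within `3·10⁻⁴`, each of `c₁₂, c₃₄, Q₃₁, Q₃₂, Q₄₁, Q₄₂, A₀, A₂, A₃, A₄` by any complex number within
`3·10⁻⁴` in both parts (the conjugate entries following), simultaneously and adversarially — `30×` the manuscript's
quoting precision `10⁻⁵` of these constants. [folklore] -/
theorem not_mainOrderContradictionP {ε : ℝ} {D : Matrix (Fin 4) (Fin 4) ℂ} {d : Fin 4 → ℂ} (hS : Small ε D d)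
    (hε : ε ≤ 3 / 10000) (w2 w3 w4 : ℂ) :
    ¬ MainOrderContradictionP D d w2 w3 w4 C233 ∧ ¬ MainOrderContradictionP D d w2 w3 w4 C233lit := by
  have hE : ε * SC ≤ E3 := le_trans (mul_le_mul_of_nonneg_right hε SC_pos.le) E3_spec
  have hk := normSq_LP_le hS hE w2 w3 w4
  have hpos : 0 ≤ C232P D w2 w3 w4 := by nlinarith [Complex.normSq_nonneg (LP d w2 w3 w4)]
  exact ⟨not_sqrt_lt_of_normSq_le hk hpos (by linarith [C233_bounds.1]),
    not_sqrt_lt_of_normSq_le hk hpos (by linarith [C233lit_bounds.1])⟩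

/-- the unperturbed case recovers `not_mainOrderContradictionG_all` (reading `C232cG`). [folklore] -/
theorem not_mainOrderContradictionP_zero (w2 w3 w4 : ℂ) :
    ¬ MainOrderContradictionG w2 w3 w4 (C232cG w2 w3 w4) C233 := by
  rw [← mainOrderContradictionP_zero]
  exact (not_mainOrderContradictionP (small_zero le_rfl) (by norm_num) w2 w3 w4).1

/-! ### The upper side: an admissible perturbation of size `6.64·10⁻⁴` closes the step -/

/-- witness radius `6.64·10⁻⁴`. [folklore] -/
def rW : ℚ := 664 / 1000000

/-- sign pattern of the witness perturbation of `Q`, real parts (symmetric). [folklore] -/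
def sRe : Fin 4 → Fin 4 → ℚ := ![![-1, -1, 1, 1], ![-1, -1, 1, 1], ![1, 1, -1, -1], ![1, 1, -1, -1]]
/-- sign pattern of the witness perturbation of `Q`, imaginary parts (antisymmetric). [folklore] -/
def sIm : Fin 4 → Fin 4 → ℚ := ![![0, -1, -1, 1], ![1, 0, -1, 1], ![1, 1, 0, -1], ![-1, -1, 1, 0]]
/-- sign pattern of the witness perturbation of `(A₀, A₂, A₃, A₄)`, real parts. [folklore] -/
def sdRe : Fin 4 → ℚ := ![1, 1, -1, -1]
/-- sign pattern of the witness perturbation of `(A₀, A₂, A₃, A₄)`, imaginary parts. [folklore] -/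
def sdIm : Fin 4 → ℚ := ![1, 1, -1, -1]

/-- the witness perturbation `D_w` of `Q` (the adversarial vertex at radius `rW`). [folklore] -/
def DW : Matrix (Fin 4) (Fin 4) ℂ := Matrix.of fun i j => cpt (sRe i j * rW) (sIm i j * rW)
/-- the witness perturbation `d_w` of `(A₀, A₂, A₃, A₄)`. [folklore] -/
def dW : Fin 4 → ℂ := fun k => cpt (sdRe k * rW) (sdIm k * rW)
/-- boxes of `D_w`. [folklore] -/
def DWB : CMat 4 := fun i j => ptB (sRe i j * rW) (sIm i j * rW)
/-- boxes of `d_w`. [folklore] -/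
def dWB : Fin 4 → CB := fun k => ptB (sdRe k * rW) (sdIm k * rW)

/-- [folklore] -/ theorem mem_DW (i j : Fin 4) : CB.mem (DW i j) (DWB i j) := mem_ptB _ _
/-- [folklore] -/ theorem mem_dW (k : Fin 4) : CB.mem (dW k) (dWB k) := mem_ptB _ _

/-- `conj (a + bi) = a − bi` on complex-rational points. [folklore] -/
theorem conj_cpt (a b : ℚ) : conj (cpt a b) = cpt a (-b) := by
  unfold cpt
  simp only [map_add, map_mul, map_ratCast, Complex.conj_I, Rat.cast_neg]
  ring

/-- [folklore] -/
theorem cpt_re (a b : ℚ) : (cpt a b).re = a := by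
  simp [cpt]

/-- [folklore] -/
theorem cpt_im (a b : ℚ) : (cpt a b).im = b := by
  simp [cpt]

/-- `D_w` is Hermitian. [folklore] -/
theorem DW_conjTranspose : DWᴴ = DW := by
  ext i j
  simp only [DW, Matrix.conjTranspose_apply, Matrix.of_apply, Complex.star_def, conj_cpt]
  fin_cases i <;> fin_cases j <;> simp [sRe, sIm]

/-- the witness perturbation is admissible of size `6.64·10⁻⁴`. [folklore] -/
theorem small_W : Small ((664 : ℝ) / 1000000) DW dW := by
  refine ⟨DW_conjTranspose, fun i j => ?_, fun k => ?_⟩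
  · simp only [DW, Matrix.of_apply, cpt_re, cpt_im]
    fin_cases i <;> fin_cases j <;> norm_num [sRe, sIm, rW]
  · simp only [dW, cpt_re, cpt_im]
    fin_cases k <;> norm_num [sdRe, sdIm, rW]

/-- the closing point `ι_w` (5-decimal rounding of the maximiser of `|L′|²/C₂₃₂′` at `(D_w, d_w)`). [folklore] -/
def iW2 : ℂ := cpt (152727/100000) (-7441/100000)
/-- [folklore] -/ def iW3 : ℂ := cpt (-97104/100000) (-24758/100000)
/-- [folklore] -/ def iW4 : ℂ := cpt (-148787/100000) (41210/100000)
/-- [folklore] -/ def bW2 : CB := ptB (152727/100000) (-7441/100000)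
/-- [folklore] -/ def bW3 : CB := ptB (-97104/100000) (-24758/100000)
/-- [folklore] -/ def bW4 : CB := ptB (-148787/100000) (41210/100000)

/-- box table of `Q + D_w`. [folklore] -/
def QPB : CMat 4 := fun i j => (QL i j).add (DWB i j)
/-- boxes of `A_k + d_w,k`. [folklore] -/
def ALW : Fin 4 → CB := fun k => (ALv k).add (dWB k)
/-- box of `C₂₃₂′(ι_w) = Re x*(Q + D_w)x`. [folklore] -/
def TPBox : FI := (formB QPB (xB bW2 bW3 bW4)).re
/-- box of `L′(ι_w)`. [folklore] -/
def LPBox : CB := (((ALW 0).add (bW2.mul (ALW 1))).add (bW3.mul (ALW 2))).add (bW4.mul (ALW 3))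

/-- `C₂₃₂′(ι_w) ∈ TPBox`. [folklore] -/
theorem mem_TPBox : FI.mem (C232P DW iW2 iW3 iW4) TPBox := by
  have hM : CMMem (QM c34c 0 + DW) QPB := fun i j => by
    rw [Matrix.add_apply]; exact CB.mem_add (mem_QL i j) (mem_DW i j)
  have hx : ∀ i, CB.mem (xvec iW2 iW3 iW4 i) (xB bW2 bW3 bW4 i) :=
    mem_xB (mem_ptB _ _) (mem_ptB _ _) (mem_ptB _ _)
  have h := (mem_formB hx hM).1
  have hq : (star (xvec iW2 iW3 iW4) ⬝ᵥ (QM c34c 0 *ᵥ xvec iW2 iW3 iW4)).re = C232cG iW2 iW3 iW4 := by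
    rw [form_QM_re, Rat.cast_zero, sub_zero]; rfl
  have e : (star (xvec iW2 iW3 iW4) ⬝ᵥ ((QM c34c 0 + DW) *ᵥ xvec iW2 iW3 iW4)).re = C232P DW iW2 iW3 iW4 := by
    rw [Matrix.add_mulVec, dotProduct_add, Complex.add_re, hq]; rfl
  rw [e] at h
  exact h

/-- `L′(ι_w) ∈ LPBox`. [folklore] -/
theorem mem_LPBox : CB.mem (LP dW iW2 iW3 iW4) LPBox := by
  rw [LP_eq]
  unfold LformP LPBox
  exact CB.mem_add (CB.mem_add (CB.mem_add (CB.mem_add (mem_avec 0) (mem_dW 0))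
    (CB.mem_mul (mem_ptB _ _) (CB.mem_add (mem_avec 1) (mem_dW 1))))
    (CB.mem_mul (mem_ptB _ _) (CB.mem_add (mem_avec 2) (mem_dW 2))))
    (CB.mem_mul (mem_ptB _ _) (CB.mem_add (mem_avec 3) (mem_dW 3)))

/-- the three integer endpoint comparisons: `0 < C₂₃₂′(ι_w).lo`, `C₂₃₂′(ι_w).hi · 2546.8478 < |L′(ι_w)|².lo` and the
same with `2547.0321` (upper ends of `C233`, `C233lit`). [folklore] -/
def WitnessPProp : Prop :=
  0 < TPBox.lo ∧ (TPBox.mulInt 25468478).hi < ((CB.normSqFI LPBox).mulInt 10000).lo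
    ∧ (TPBox.mulInt 25470321).hi < ((CB.normSqFI LPBox).mulInt 10000).lo

/-- [folklore] -/
instance : Decidable WitnessPProp := by unfold WitnessPProp; infer_instance

/-- **The kernel check of the witness.** [folklore] -/
theorem witnessP_cert : WitnessPProp := by decide +kernel

/-- from the box comparison to the real inequality. [folklore] -/
theorem closes_of_cmp {T N c : ℝ} {TB NB : FI} (hT : FI.mem T TB) (hN : FI.mem N NB) (h0 : 0 < TB.lo)
    {p : ℤ} (hp : (TB.mulInt p).hi < (NB.mulInt 10000).lo) (hc : c < (p : ℝ) / 10000) :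
    0 < T ∧ T * c < N := by
  have hS := SC_pos
  have hTpos : 0 < T := by
    have h1 := hT.1
    have h0' : (0 : ℝ) < TB.lo := by exact_mod_cast h0
    nlinarith
  have hlt := FI.lt_of_hi_lt_lo (FI.mem_mulInt hT p) (FI.mem_mulInt hN 10000) hp
  push_cast at hlt
  refine ⟨hTpos, ?_⟩
  have h2 : T * c < T * ((p : ℝ) / 10000) := mul_lt_mul_of_pos_left hc hTpos
  nlinarith

/-- **The witness closes the perturbed step**, in both readings of `C₂₃₃`. [folklore] -/
theorem witnessP_closes :
    MainOrderContradictionP DW dW iW2 iW3 iW4 C233 ∧ MainOrderContradictionP DW dW iW2 iW3 iW4 C233lit := by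
  have hT := mem_TPBox
  have hN := CB.mem_normSqFI mem_LPBox
  obtain ⟨h0, h1, h2⟩ := witnessP_cert
  have hc : C233 < ((25468478 : ℤ) : ℝ) / 10000 := by
    have := C233_bounds.2; push_cast; linarith
  have hcl : C233lit < ((25470321 : ℤ) : ℝ) / 10000 := by
    have := C233lit_bounds.2; push_cast; linarith
  have k1 := closes_of_cmp hT hN h0 h1 hc
  have k2 := closes_of_cmp hT hN h0 h2 hcl
  have key : ∀ {c : ℝ}, 0 < C232P DW iW2 iW3 iW4 → C232P DW iW2 iW3 iW4 * c < Complex.normSq (LP dW iW2 iW3 iW4) →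
      0 < c → MainOrderContradictionP DW dW iW2 iW3 iW4 c := by
    intro c hTpos hlt hcpos
    have hNpos : 0 < Complex.normSq (LP dW iW2 iW3 iW4) := lt_trans (mul_pos hTpos hcpos) hlt
    have hy : 0 < ‖LP dW iW2 iW3 iW4‖ := by
      rw [norm_pos_iff]; intro hz; rw [hz, map_zero] at hNpos; exact lt_irrefl _ hNpos
    unfold MainOrderContradictionP
    rw [Real.sqrt_lt' hy, Complex.sq_norm]
    exact hlt
  exact ⟨key k1.1 k1.2 (by linarith [C233_bounds.1]), key k2.1 k2.2 (by linarith [C233lit_bounds.1])⟩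

/-- **The bracket of the joint radius.**  The least sup-size `ρ*` of an admissible joint perturbation of the
entry-level constants under which SOME `ι ∈ ℂ³` closes the final step of §2 at main order (certified `C₂₃₃`)
satisfies `3·10⁻⁴ ≤ ρ* < 6.64·10⁻⁴`: nothing closes at size `≤ 3·10⁻⁴`; `(D_w, d_w)` of size `6.64·10⁻⁴` closes
at `ι_w` (outside Lean: `5.438·10⁻⁴ ≤ ρ* ≤ 6.628·10⁻⁴`). [folklore] -/
theorem joint_radius_bracket :
    (∀ (ε : ℝ) (D : Matrix (Fin 4) (Fin 4) ℂ) (d : Fin 4 → ℂ), Small ε D d → ε ≤ 3 / 10000 →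
        ∀ w2 w3 w4 : ℂ, ¬ MainOrderContradictionP D d w2 w3 w4 C233)
    ∧ (∃ (D : Matrix (Fin 4) (Fin 4) ℂ) (d : Fin 4 → ℂ), Small ((664 : ℝ) / 1000000) D d ∧
        ∃ w2 w3 w4 : ℂ, MainOrderContradictionP D d w2 w3 w4 C233) :=
  ⟨fun _ _ _ hS hε w2 w3 w4 => (not_mainOrderContradictionP hS hε w2 w3 w4).1,
    ⟨DW, dW, small_W, iW2, iW3, iW4, witnessP_closes.1⟩⟩

end Literature.NumberTheory.LFunctions.Zhang2022

/-! ## `_holds` aliases (appended 2026-08-28, flt-inv gen 65)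

The named fact(s) below are already theorems of THIS file under another name; the alias records the
discharge under the tree's exact naming convention `X_holds` (D-0026 bookkeeping: the proof term is the
existing theorem; no statement, definition or attribute is edited; no new named fact).  The ledger's debt
table listed each as unproved (`ledger fact claim` GRANTED «status unproved», 2026-08-28T08:5xZ). -/

/-- `WitnessPProp` — the kernel certificate of the joint-robustness witness for the final step of §2 at main order (the thirteen entry-level constants of (2.32)–(2.33)) holds (`decide +kernel`) (`Literature.NumberTheory.LFunctions.Zhang2022.witnessP_cert`). [cite: Zhang2022LandauSiegel, §2 (2.32)–(2.33)] -/
theorem _root_.Literature.NumberTheory.LFunctions.Zhang2022.WitnessPProp_holds : _root_.Literature.NumberTheory.LFunctions.Zhang2022.WitnessPProp :=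
  _root_.Literature.NumberTheory.LFunctions.Zhang2022.witnessP_cert
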